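import Summits.NavierStokesRegularity.NavierStokesRegularity.Cruxes.BoundedTemperatureClosed.SketchIdeator4
import Summits.NavierStokesRegularity.NavierStokesRegularity.Cruxes.BoundedTemperatureClosed.SketchIdeator5
import Summits.NavierStokesRegularity.NavierStokesRegularity.Theorems.BoundedTemperatureClosed.Negative.H10DataBites

/-!
# TRIAGE r2 · triager 2 — kernel checks for the three round-2 ideas of crux
# `BoundedTemperatureClosed` (stmt-NavierStokesRegularity-18303)

Refuter `refuter-cruxtri-stmt-NavierStokesRegularity-18303-r2-2-0`, 2026-08-17. Companion of `TRIAGE.md`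
(published as `TRIAGE-r2-2.md`). No `sorry`; nothing here is a stub, a skeleton, or closes anything.

COMMON SHAPE OF THE THREE CARDS (made kernel-visible below). Write `H := TypeIInfimumNotAttainedNS`
(registered, p146867: some `K > 0` is not a SCHWARTZ Type-I ceiling of Navier–Stokes though every `K' > K`
is). Each round-2 card splits the crux's zero-datum core `¬H` as

  (attainment / compactness in a BIGGER class `X`)  ∧  (no `X`/Schwartz gap at the infimum),

with `X = H¹⁰_df` (cards gkp-critical-temperature + signed-terminal-descent; inside an energy budget) or
`X =` Albritton–Barker's local suitable class (card temperature-buys-morrey-budget). The checks: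

* §1 `relaxedClosedH10_false_of_H10` — card 1's line stub `RelaxedClosedIn h10Data` ALONE is refuted by
  `H′ := TypeIInfimumNotAttainedNSH10` (the `H¹⁰_df`-data twin of `H`, same logical status: a proof needs an
  NS blow-up, a disproof needs Type-I exclusion or attainment); `tradeoffNS_false_of_H` — granting the card's
  two "engine" pieces, `H` kills exactly `TradeoffNS` (the piece the card grades "no proof technology today").
* §2 `schwartzSaturationH10_false_of_gap` — card 2's typed target `SchwartzSaturationIn h10Data` ALONE is
  refuted by an `H¹⁰_df`/Schwartz ceiling gap `GapH10`; and `h10_or_gap_of_H : H → H′ ∨ GapH10` — so the two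
  stubs of line `SketchIdeator4` carry `¬H` as `¬H′` (relaxed closedness) and `¬GapH10` (saturation): the split
  RELOCATES `¬H` into two open NS statements, one per stub (criterion (iv) of TRIAGE-r1, per stub).
* §3 `bigClassGap_of_H_of_bigClassAttain`, `exactSchwartzReentry_false_of_bigClassGap` — card 3's
  theorem-grade `BigClassAttain` turns `H` into a big-class/Schwartz gap, which is exactly what refutes its
  named residue `ExactSchwartzReentry` (the card says so in prose; here in the kernel).
-/

noncomputable section

open MeasureTheory Set Filter Topology
open scoped ENNReal
open Literature.Analysis.FluidPDE Literature.Analysis.FluidPDE.Tao2016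
open Summit.NavierStokesRegularity.NavierStokesRegularity.Cruxes.BoundedTemperatureClosed.Disproof
  (segForm btSet NSTypeICeiling TypeIInfimumNotAttainedNS crux_false_of_typeIInfimumNotAttainedNS)
open Summit.NavierStokesRegularity.NavierStokesRegularity.Cruxes.BoundedTemperatureClosed.IdeasK4

-- nested summit namespace is the tree layout (D-0017)
set_option linter.dupNamespace false

namespace Summit.NavierStokesRegularity.NavierStokesRegularity.Cruxes.BoundedTemperatureClosed.TriageR2K2

/-! ### §0 Vocabulary -/

/-- Navier–Stokes has an `H¹⁰_df`-DATA `H¹⁰_df`-mild Type-I blow-up at ceiling `K` with no mild extension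
(the RELAXED membership predicate of line `SketchIdeator4` at the Euler end). -/
def NSTypeICeilingH10 (K : ℝ) : Prop :=
  ∃ a : L2C, MemH10df a ∧ IsTypeIWitness eulerForm K a

/-- **`H′` — the `H¹⁰_df` twin of `H`**: the infimal Type-I ceiling of Navier–Stokes over `H¹⁰_df` data is
finite but not attained. Same logical status as `H` (contains an NS blow-up; its negation beyond Type-I
exclusion is Rusin–Šverák's question (Q) for the temperature functional in a finite-energy class). -/
def TypeIInfimumNotAttainedNSH10 : Prop :=
  ∃ K : ℝ, 0 < K ∧ ¬ NSTypeICeilingH10 K ∧ ∀ K' : ℝ, K < K' → NSTypeICeilingH10 K'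

/-- **`GapH10`**: some ceiling is realised by an `H¹⁰_df` datum but by no Schwartz datum. -/
def GapH10 : Prop := ∃ K : ℝ, NSTypeICeilingH10 K ∧ ¬ NSTypeICeiling K

/-- **`GapBig`**: some positive ceiling is realised in Albritton–Barker's local class (card 3's
`BigClassCeiling`) but by no Schwartz datum. FALSE-able model: cubic heat, `K = 1/√2` (ROUND2-k5 §2). -/
def GapBig : Prop := ∃ K : ℝ, 0 < K ∧ Ideator5.BigClassCeiling K ∧ ¬ NSTypeICeiling K

/-- Schwartz ceilings are `H¹⁰_df` ceilings (landed `memH10df_schwartzL2`, via `nsTypeIH10_of_nsTypeI`). -/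
theorem nsTypeICeilingH10_of_nsTypeICeiling {K : ℝ} (h : NSTypeICeiling K) : NSTypeICeilingH10 K :=
  Theorems.BoundedTemperatureClosed.Negative.nsTypeIH10_of_nsTypeI h

/-- The registered `H` of the Negative lane is Disproof's `H` (definitional). -/
theorem typeIInfimumNotAttainedNS_iff :
    TypeIInfimumNotAttainedNS ↔ Theorems.BoundedTemperatureClosed.Negative.TypeIInfimumNotAttainedNS :=
  Iff.rfl

/-! ### §1 Card gkp-critical-temperature: the relaxed-closedness stub is pinned to `¬H′` -/

/-- **`H′ → ¬ stub_relaxedClosedH10`.** Relaxed closedness alone attains the infimal `H¹⁰_df` ceiling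
(landed `nsTypeIH10_of_forall_lt_of_relaxedClosedH10`, p162218, zero datum at ceiling `2K`), so it is false
modulo `H′` — the `H¹⁰_df` copy of the negative lemma `H → ¬crux` (p146867). Per-stub form of criterion (iv). -/
theorem relaxedClosedH10_false_of_H10 (hH : TypeIInfimumNotAttainedNSH10) : ¬ RelaxedClosedIn h10Data :=
  fun hR => by
  obtain ⟨K, hK, hnot, hall⟩ := hH
  exact hnot (Theorems.BoundedTemperatureClosed.Negative.nsTypeIH10_of_forall_lt_of_relaxedClosedH10 hR hK hall)

/-- Conversely the stub kills `H′` (contrapositive, recorded for the bite table: row (g) ⟹ ¬H′). -/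
theorem not_H10_of_relaxedClosedH10 (hR : RelaxedClosedIn h10Data) : ¬ TypeIInfimumNotAttainedNSH10 :=
  fun hH => relaxedClosedH10_false_of_H10 hH hR

/-- **Where `H` bites inside the card's own three-way split.** Granting the two pieces the card grades
theorem-grade / mechanism-backed (`BudgetedAttainNS` = GKP extraction inside a budget, `SchwartzSaturationNS`
= signed terminal descent), `H` refutes exactly `TradeoffNS` (near-minimal witnesses inside ONE energy budget)
— the piece the card itself grades "hypothesis-grade, no proof technology today", FALSE in the semilinear heat
sibling (BN5). Contrapositive of the ideator's `not_typeIInfimumNotAttainedNS_of_split`. -/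
theorem tradeoffNS_false_of_H (hH : TypeIInfimumNotAttainedNS) (h2 : BudgetedAttainNS)
    (h3 : SchwartzSaturationNS) : ¬ TradeoffNS :=
  fun h1 => not_typeIInfimumNotAttainedNS_of_split h1 h2 h3 hH

/-- … and symmetrically `H` + Tradeoff + budgeted attainment refute the zero-datum saturation. -/
theorem schwartzSaturationNS_false_of_H (hH : TypeIInfimumNotAttainedNS) (h1 : TradeoffNS)
    (h2 : BudgetedAttainNS) : ¬ SchwartzSaturationNS :=
  fun h3 => not_typeIInfimumNotAttainedNS_of_split h1 h2 h3 hH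

/-! ### §2 Card signed-terminal-descent: the saturation target is pinned to `¬GapH10`; the split covers `H` -/

/-- **`GapH10 → ¬ SchwartzSaturationIn h10Data`.** Saturation read at the Euler datum is exact Schwartz
re-entry at every ceiling (landed `nsTypeI_of_nsTypeIH10_of_schwartzSaturationH10`, p162218), so one
`H¹⁰_df`/Schwartz ceiling gap refutes it. Per-stub form of criterion (iv) for the card's typed target. -/
theorem schwartzSaturationH10_false_of_gap (hG : GapH10) : ¬ SchwartzSaturationIn h10Data := fun hS => by
  obtain ⟨K, hK, hnot⟩ := hG
  exact hnot (Theorems.BoundedTemperatureClosed.Negative.nsTypeI_of_nsTypeIH10_of_schwartzSaturationH10 hS hK)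

/-- Conversely saturation kills the gap. -/
theorem not_gap_of_schwartzSaturationH10 (hS : SchwartzSaturationIn h10Data) : ¬ GapH10 :=
  fun hG => schwartzSaturationH10_false_of_gap hG hS

/-- **`H → H′ ∨ GapH10`**: under `H` (at its `K`), either `K` is not even an `H¹⁰_df` ceiling — then `H′`
holds at `K`, since every `K' > K` is a Schwartz hence `H¹⁰_df` ceiling — or it is, and then `K` is an
`H¹⁰_df`/Schwartz gap. So the line's two stubs carry `¬H` as `¬H′` and `¬GapH10` respectively. -/
theorem h10_or_gap_of_H (hH : TypeIInfimumNotAttainedNS) : TypeIInfimumNotAttainedNSH10 ∨ GapH10 := by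
  obtain ⟨K, hK, hnot, hall⟩ := hH
  by_cases h : NSTypeICeilingH10 K
  · exact Or.inr ⟨K, h, hnot⟩
  · exact Or.inl ⟨K, hK, h, fun K' hK' => nsTypeICeilingH10_of_nsTypeICeiling (hall K' hK')⟩

/-- Hence `¬H′ ∧ ¬GapH10 → ¬H`: the two per-stub obstructions jointly ARE the crux's open core. -/
theorem not_H_of_not_H10_of_not_gap (h1 : ¬ TypeIInfimumNotAttainedNSH10) (h2 : ¬ GapH10) :
    ¬ TypeIInfimumNotAttainedNS :=
  fun hH => (h10_or_gap_of_H hH).elim h1 h2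

/-- The same through the stubs: relaxed closedness + saturation ⟹ `¬H′ ∧ ¬GapH10` ⟹ `¬H` (a second proof
of lead a1's `not_typeIInfimumNotAttainedNS_of_stubs`, factorised through the two named obstructions). -/
theorem not_H_of_stubs (hR : RelaxedClosedIn h10Data) (hS : SchwartzSaturationIn h10Data) :
    ¬ TypeIInfimumNotAttainedNS :=
  not_H_of_not_H10_of_not_gap (not_H10_of_relaxedClosedH10 hR) (not_gap_of_schwartzSaturationH10 hS)

/-! ### §3 Card temperature-buys-morrey-budget: `BigClassAttain` turns `H` into the gap that kills re-entry -/

/-- Ideator 5's `NSTypeICeiling` is Disproof's (definitional). -/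
theorem nsTypeICeiling5_iff (K : ℝ) : Ideator5.NSTypeICeiling K ↔ NSTypeICeiling K := Iff.rfl

/-- **`H ∧ BigClassAttain → GapBig`**: at `H`'s ceiling `K` all `K' > K` are Schwartz ceilings, so the
(claimed theorem-grade) big-class attainment makes `K` a big-class ceiling, while `K` is no Schwartz ceiling. -/
theorem bigClassGap_of_H_of_bigClassAttain (hH : TypeIInfimumNotAttainedNS) (hA : Ideator5.BigClassAttain) :
    GapBig := by
  obtain ⟨K, hK, hnot, hall⟩ := hH
  exact ⟨K, hK, hA K hK (fun K' hK' => (nsTypeICeiling5_iff K').2 (hall K' hK')), hnot⟩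

/-- **`GapBig → ¬ ExactSchwartzReentry`** (the card's named `¬H`-carrier is exactly "no big-class/Schwartz
gap"; model-false: cubic heat has the gap at `K = 1/√2`, ROUND2-k5 §2). -/
theorem exactSchwartzReentry_false_of_bigClassGap (hG : GapBig) : ¬ Ideator5.ExactSchwartzReentry :=
  fun hR => by
  obtain ⟨K, hK, hbig, hnot⟩ := hG
  exact hnot ((nsTypeICeiling5_iff K).1 (hR K hK hbig))

/-- Hence `H → BigClassAttain → ¬ ExactSchwartzReentry` (contrapositive of the ideator's glue, through the gap). -/
theorem exactSchwartzReentry_false_of_H_of_bigClassAttain (hH : TypeIInfimumNotAttainedNS)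
    (hA : Ideator5.BigClassAttain) : ¬ Ideator5.ExactSchwartzReentry :=
  exactSchwartzReentry_false_of_bigClassGap (bigClassGap_of_H_of_bigClassAttain hH hA)

/-- Sanity / bookkeeping: under `H` Navier–Stokes has a Schwartz Type-I blow-up, hence (card 3's PROVED
warm-up `mildTypeICeilingIsLocalTypeI`) an Albritton–Barker local Type-I singularity — `H` lives entirely
inside the blow-up world, consistent with Disproof §(c),(f) (no unconditional kill either way). -/
theorem localTypeISingularityExists_of_H (hH : TypeIInfimumNotAttainedNS) : LocalTypeISingularityExists := by
  obtain ⟨K, hK, -, hall⟩ := hH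
  exact Ideator5.mildTypeICeilingIsLocalTypeI (K + 1) ((nsTypeICeiling5_iff (K + 1)).2 (hall (K + 1) (by linarith)))

end Summit.NavierStokesRegularity.NavierStokesRegularity.Cruxes.BoundedTemperatureClosed.TriageR2K2

end
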